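import Summits.QuantumFields.YangMills.Theorems.BalabanUVNodesN15CovariantAveragingHolonomyFit
import Literature.NumberTheory.Sieve.CoprimeSquarefreeSumsBounds
import HarnessLib

/-!
# Route «BalabanUVNodes», node N15 = NE2, road (c) — PROGRAMME (P-Q), Vc: THE LINE AND PATH HOLONOMIES OF (125) AT TWO SPACINGS FIT — for a fine skew field `A′` with the (3.35) letters
# `‖A′‖ ≤ r_A`, `‖A′(b′ + e′) − A′(b′)‖ ≤ r_Aη′` and its block mean `Ā′ = gavgM π̂ A′`, the holonomy of `e^{η′A′}` along the fine path `(x′, L^ms + j)` and the holonomy of `e^{ηĀ′}`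
# along its projected coarse partner `(πx′, s + δ)` differ by `≤ C_d·r_A·η` (`η = L^{−k}`): the staircases by this seat's g4 `norm_stairProd_two_spacing_le`, the lines factor by factor

Cell `pub-ymgap`, seat `pub-ymgap-dag-n15-c` (generation g21; R134 (a) seat, strategy s1; HUMAN RULING D-0062; chair R424 venue).  `bears_on: R4∕N15 · K3⁸ SpineGivenEndpointR13SepCoPHV
(stmt-QuantumFields-27366)`; filed `--supports stmt-QuantumFields-27366 --as helper` — COUNT-NEUTRAL.  THEOREMS only ([folklore] lattice ∕ Banach-algebra bookkeeping), 0 `def`, 0 `sorry`.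
Imports BY NAME, nothing in the tree modified ∕ restated: n15-c∕185b `…CovariantAveragingHolonomyFit` (`norm_holStair_two_grid_le`, `kingPr_add_smul_of_dvd`, `exists_cellStart`, `norm_sub_gavgM_kingPrV_le`,
`holLine_add`, `holLine_exp_smul_natCast`, `norm_mprod_sub_one_le`, `norm_mprod_sub_mprod_le`, `norm_unitary_mul_eq`; through it 185a `holLeg`∕`holStair`∕`holLine`∕`holPath`, 181
`mprod`∕`mprod_add`∕`mprod_eq_oprod`), FILE 130 `…CurvedKnitSmallFieldDefect` (through it this seat's g4 `…ContourProducts`: `stairProd`, `legProd`, ★ `norm_stairProd_two_spacing_le`,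
`exp_natCast_smul`; `…OrderedProducts`: `norm_oprod_sub_oprod_le`, `norm_oprod_sub_one_le`; dag-n15-a `kingPr`∕`kingPrV`∕`kingPr_val`∕`kingPr_bpt_hdig`∕`hdig`; n15-b `gavgM`∕`fit_blockAvgV`∕
`norm_blockAvgV_le`∕`norm_exp_sub_exp_le`; (V4) `fibre_conn_kingPrV`; `Literature.Analysis.Calculus.norm_exp_sub_one_le`), Mathlib `CStarRing.norm_mem_unitary_mul`.

WHY.  n15-c∕184a∕184b bound the two-grid η-defects of the covariant averaging shapes by `(φ + 2B∕L^k)·e^{ρ′}e^{−ρ′d}` with `φ` the FIT between each fine kernel `cvaPath T′ (x′, L^ms + j)` and its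
projected coarse partner `cvaPath T (πx′, s + δ)`; n15-c∕185a reduced `φ` to the HOLONOMY difference `‖U′(Γ′) − U(Γ)‖_{op}`.  THIS FILE bounds that difference in FILE 130's currency (fine
`U′ = e^{η′A′}`, coarse `U = e^{ηĀ′}`, `Ā′ = gavgM π̂ A′`, `η = L^mη′`): the STAIRCASE part is this seat's g4 theorem verbatim (`holStair (e^{X}) = stairProd X`, `X′ = η′A′`, `L^m•X̃ = ηĀ′`,
fit `ω = η′Ω`, `Ω = 2(d+1)(L^m − 1)r_Aη′` the fibre oscillation); the LINE part: move the fine start `x′` back to the first fine point `x̂′` of its coarse cell (`c < L^m` steps, cost `e^{ηr_A} − 1`),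
write the coarse line as `L^m(s + δ)` fine-step factors (`e^{ηĀ′} = (e^{η′Ā′})^{L^m}`), compare factor by factor (`π̂(x̂′ + te′) = πx′ + ⌊t∕L^m⌋e` exactly; each pair within `η′(Ω + 0)`), and
absorb the `(c + j) mod L^m < L^m` surplus fine factors (`e^{ηr_A} − 1`).  Everything is `O(r_A·η)` — [Balaban1985BackgroundPropagators] (3.73)-type two-spacing comparison for the
averaging transports (mechanism; King's Prop. 3.9 shape), [Balaban1985Averaging] (126) «|(Q₀A)_c| ≤ |A|».

RESULTS ([folklore]).
* `delta_eq_div` (the pairing step from the cell start), `holStair_unitary`, `holLine_unitary`, ★ `norm_holLine_two_grid_le`, ★★ **`norm_holPath_two_grid_le`**.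

HONEST FRAMING ∕ LIMITS.  Bookkeeping for the MODEL transports of n15-c∕181 (main term (125), one-level staircase); FILE 130's small-field currency (skew `A′`, block-mean coarse field —
the linearised (C3) transport); crude constants.  NE2⁺ NOT PRINTED; N15 of record untouched (DISCHARGED AS CONSUMED); counts UNMOVED (typed 28∕28); one finite 𝕋⁴ at fixed ε per index — NOT
infinite volume ∕ OS ∕ mass gap ∕ Clay.  Restate-immune (no Theses import).
-/

noncomputable section

open scoped BigOperators Matrix
open Finset NormedSpace

namespace Summit.QuantumFields.YangMills.BalabanUVNodes.N15.CovAvg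

open Literature.MathematicalPhysics.QuantumFieldTheory.Balaban1983to89
open Literature.MathematicalPhysics.QuantumFieldTheory.Balaban1983to89.B5Prop11Plancherel (Tor fine unitVec)
open Literature.MathematicalPhysics.QuantumFieldTheory.Balaban1983to89.B5Block118 (bpt)
open Literature.MathematicalPhysics.QuantumFieldTheory.Balaban1983to89.B5Blocks16 (bpt_bijective)
open Literature.MathematicalPhysics.QuantumFieldTheory.Balaban1983to89.B7Prop6Bound (oprod)
open Literature.Analysis.Calculus (norm_exp_sub_one_le)
open Summit.QuantumFields.YangMills.BalabanUVNodes.N15.VectorPiece (bondAt blockCoords blockCoords_bpt kingPr kingPrV kingPr_val kingPrV_eq kingPr_bpt_hdig hdig stairProd legProd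
  norm_stairProd_two_spacing_le exp_natCast_smul norm_oprod_sub_oprod_le norm_oprod_sub_one_le oprod_congr oprod_succ fibre_conn_kingPrV bshiftEquiv bshiftEquiv_apply)
open Summit.QuantumFields.YangMills.BalabanUVNodes.N15.MatrixSpecies (fit_blockAvgV norm_blockAvgV_le norm_exp_sub_exp_le)
open Summit.QuantumFields.YangMills.BalabanUVNodes.N15.BackgroundLayer (gavgM)
open Summit.QuantumFields.YangMills.BalabanUVNodes.N15.TwoGrid (kingPr_add_smul_unitVec_of_le)

open Literature.NumberTheory.Sieve.SquarefreeSums (exp_sub_one_le_two_mul)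

variable {d : ℕ}

/-! ## §3 The line and the path at two spacings -/

section TwoGrid

open scoped Matrix.Norms.L2Operator

variable {L : ℕ} [NeZero L] (M : Fin (d + 1) → ℕ) [∀ μ, NeZero (M μ)] (k m : ℕ) {mm : Type} [Fintype mm] [DecidableEq mm]

/-- The pairing step is fixed by the cell start: if `π(x′ + je′) = πx′ + δe` with `δ ≤ 1`, `x′ = x̂′ + ce′` (`L^m ∣ x̂′_μ`, `πx̂′ = πx′`) and the coarse torus has `≥ 2` sites in direction `μ`,
then `δ = ⌊(c + j)∕L^m⌋`. [cite: King1986, p.664 (pairing convention)] -/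
theorem delta_eq_div {x' xh : Tor (fine (L ^ m * L ^ k) M)} {μ : Fin (d + 1)} {c j δ : ℕ} (hcL : c < L ^ m) (hj : j < L ^ m) (hδ : δ ≤ 1) (hM2 : 2 ≤ L ^ k * M μ)
    (hdvd : L ^ m ∣ (xh μ).val) (hx' : x' = xh + c • unitVec (fine (L ^ m * L ^ k) M) μ) (hπh : kingPr L k m M xh = kingPr L k m M x')
    (hπ : kingPr L k m M (x' + j • unitVec (fine (L ^ m * L ^ k) M) μ) = kingPr L k m M x' + δ • unitVec (fine (L ^ k) M) μ) :
    δ = (c + j) / L ^ m := by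
  have hLm : 0 < L ^ m := pow_pos (Nat.pos_of_ne_zero (NeZero.ne L)) m
  have h2 : kingPr L k m M (x' + j • unitVec (fine (L ^ m * L ^ k) M) μ) = kingPr L k m M x' + ((c + j) / L ^ m) • unitVec (fine (L ^ k) M) μ := by
    rw [hx', add_assoc, ← add_smul, kingPr_add_smul_of_dvd M L k m xh μ hdvd (c + j), hπh, ← hx']
  rw [hπ] at h2
  have h3 := congrFun (add_left_cancel h2) μ
  simp only [Pi.smul_apply, unitVec, Pi.single_eq_same, nsmul_eq_mul, mul_one] at h3
  have hδ0 : (c + j) / L ^ m < 2 := Nat.div_lt_of_lt_mul (by omega)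
  have h4 := (ZMod.natCast_eq_natCast_iff' δ ((c + j) / L ^ m) (fine (L ^ k) M μ)).mp h3
  rwa [Nat.mod_eq_of_lt (lt_of_lt_of_le (by omega) hM2), Nat.mod_eq_of_lt (lt_of_lt_of_le hδ0 hM2)] at h4

variable [Nonempty mm]

set_option maxHeartbeats 400000 in
/-- ★ **THE LINES AT TWO SPACINGS**: skew-Hermitian `A′` with `‖A′‖ ≤ r_A ≤ 1` and unit-step differences `≤ r_Aη′`; `Ā′ = gavgM π̂ A′`; `s < L^k`, `j < L^m`, `δ ≤ 1` with
`π(x′ + je′_μ) = πx′ + δe_μ`; coarse torus with `≥ 2` sites in direction `μ`.  Then the fine line holonomy from `x′` of `L^ms + j` steps and the coarse line holonomy from `πx′` of `s + δ` steps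
differ by `≤ 2(1 + e)·r_Aη + e²·2(d+1)(L^m−1)·r_Aη′` (`η = L^{−k}`, `η′ = (L^mL^k)^{−1}`): move to the cell start (`e^{ηr_A} − 1 ≤ 2ηr_A`), compare `L^m(s + δ)` factors position by position (fibre
oscillation), absorb the `(c + j) mod L^m` surplus factors. [cite: Balaban1985BackgroundPropagators, (3.73) p.405 (shape); Balaban1985Averaging, (126) p.36] -/
theorem norm_holLine_two_grid_le {A' : Fin (d + 1) → Tor (fine (L ^ m * L ^ k) M) × Fin (d + 1) → Matrix mm mm ℂ} {rA : ℝ} (hrA : 0 ≤ rA) (hrA1 : rA ≤ 1)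
    (hA : ∀ μ b', ‖A' μ b'‖ ≤ rA) (hstep : ∀ μ κ b', ‖A' μ (bshiftEquiv M (L ^ m * L ^ k) κ b') - A' μ b'‖ ≤ rA * ((((L ^ m * L ^ k : ℕ) : ℝ))⁻¹))
    (hAs : ∀ μ b', (A' μ b')ᴴ = -A' μ b') (x' : Tor (fine (L ^ m * L ^ k) M)) (μ : Fin (d + 1)) {s j δ : ℕ} (hs : s < L ^ k) (hj : j < L ^ m) (hδ : δ ≤ 1)
    (hM2 : 2 ≤ L ^ k * M μ) (hπ : kingPr L k m M (x' + j • unitVec (fine (L ^ m * L ^ k) M) μ) = kingPr L k m M x' + δ • unitVec (fine (L ^ k) M) μ) :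
    ‖holLine M (L ^ m * L ^ k) (fun μ b => exp (((((L ^ m * L ^ k : ℕ) : ℝ))⁻¹) • A' μ b)) (x', μ) (L ^ m * s + j) -
        holLine M (L ^ k) (fun μ b => exp (((((L ^ k : ℕ) : ℝ))⁻¹) • gavgM (Matrix mm mm ℂ) (Fin (d + 1)) (kingPrV L k m M) A' μ b)) (kingPr L k m M x', μ) (s + δ)‖ ≤
      2 * (rA * ((((L ^ k : ℕ) : ℝ))⁻¹)) + 2 * (rA * ((((L ^ k : ℕ) : ℝ))⁻¹)) * Real.exp 1 +
        Real.exp 1 * ((2 * ((d + 1) * (L ^ m - 1)) : ℕ) * (rA * ((((L ^ m * L ^ k : ℕ) : ℝ))⁻¹))) * Real.exp 1 := by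
  -- constants and scales
  have hL0 : 0 < L := Nat.pos_of_ne_zero (NeZero.ne L)
  have hLm : 0 < L ^ m := pow_pos hL0 m
  have hLk : 0 < L ^ k := pow_pos hL0 k
  have hLm0 : (0 : ℝ) < ((L ^ m : ℕ) : ℝ) := by exact_mod_cast hLm
  have hLk0 : (0 : ℝ) < ((L ^ k : ℕ) : ℝ) := by exact_mod_cast hLk
  have hn'0 : (0 : ℝ) < ((L ^ m * L ^ k : ℕ) : ℝ) := by exact_mod_cast Nat.mul_pos hLm hLk
  set η' : ℝ := ((((L ^ m * L ^ k : ℕ) : ℝ))⁻¹) with hη'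
  set η : ℝ := ((((L ^ k : ℕ) : ℝ))⁻¹) with hηdef
  set Ab := gavgM (Matrix mm mm ℂ) (Fin (d + 1)) (kingPrV L k m M) A' with hAb
  set Ω : ℝ := ((2 * ((d + 1) * (L ^ m - 1)) : ℕ) : ℝ) * (rA * η') with hΩ
  have hη'0 : 0 ≤ η' := inv_nonneg.mpr hn'0.le
  have hη0 : 0 ≤ η := inv_nonneg.mpr hLk0.le
  have hη1 : η ≤ 1 := by rw [hηdef]; exact inv_le_one_of_one_le₀ (by exact_mod_cast hLk)
  have hηη' : η = ((L ^ m : ℕ) : ℝ) * η' := by rw [hη', hηdef, Nat.cast_mul, mul_inv, ← mul_assoc, mul_inv_cancel₀ hLm0.ne', one_mul]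
  have hn'η' : ((L ^ m * L ^ k : ℕ) : ℝ) * η' = 1 := by rw [hη', mul_inv_cancel₀ hn'0.ne']
  have hΩ0 : 0 ≤ Ω := by positivity
  have hAbn : ∀ ν b, ‖Ab ν b‖ ≤ rA := fun ν b => norm_blockAvgV_le (kingPrV L k m M) hrA (hA ν) b
  have hAbs : ∀ ν b, (Ab ν b)ᴴ = -Ab ν b := fun ν b => Gluing.gavgM_conjTranspose_of_skew (kingPrV L k m M) hAs ν b
  -- the cell start and the pairing step
  obtain ⟨c, xh, hcL, hdvd, hx', hπh⟩ := exists_cellStart M L k m x' μ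
  have hδeq : δ = (c + j) / L ^ m := delta_eq_div M k m hcL hj hδ hM2 hdvd hx' hπh hπ
  set r : ℕ := (c + j) % L ^ m with hr
  have hrL : r < L ^ m := Nat.mod_lt _ hLm
  set N : ℕ := (s + δ) * L ^ m with hN
  have hNle : N ≤ L ^ m * L ^ k := by rw [hN, mul_comm]; exact Nat.mul_le_mul_left _ (by omega)
  have harith : c + (L ^ m * s + j) = N + r := by
    have hcj : c + j = L ^ m * ((c + j) / L ^ m) + r := (Nat.div_add_mod (c + j) (L ^ m)).symm
    rw [hN, hδeq]
    calc c + (L ^ m * s + j) = L ^ m * s + (c + j) := by ring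
      _ = L ^ m * s + (L ^ m * ((c + j) / L ^ m) + r) := by rw [← hcj]
      _ = (s + (c + j) / L ^ m) * L ^ m + r := by ring
  -- the fine factors, their unitarity and size
  set U' : Fin (d + 1) → Tor (fine (L ^ m * L ^ k) M) × Fin (d + 1) → Matrix mm mm ℂ := fun μ b => exp (η' • A' μ b) with hU'
  have hU'u : ∀ ν b, (U' ν b)ᴴ * U' ν b = 1 := fun ν b => CurvedSpecies.exp_smul_unitary_of_conjTranspose (hAs ν b) η'
  set κ : ℝ := Real.exp (η' * rA) - 1 with hκ
  have hκ0 : 0 ≤ κ := by rw [hκ]; have := Real.one_le_exp (mul_nonneg hη'0 hrA); linarith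
  have h1κ : 1 + κ = Real.exp (η' * rA) := by rw [hκ]; ring
  have hU'1 : ∀ ν b, ‖U' ν b - 1‖ ≤ κ := fun ν b => norm_exp_smul_sub_one_le hη'0 (hA ν b)
  -- sizes of the three line pieces
  have hpow : ∀ q : ℕ, q ≤ L ^ m → (1 + κ) ^ q - 1 ≤ 2 * (rA * η) := fun q hq => by
    rw [h1κ, ← Real.exp_nat_mul]
    have hx1 : (q : ℝ) * (η' * rA) ≤ rA * η := by
      rw [hηη']
      have : (q : ℝ) ≤ ((L ^ m : ℕ) : ℝ) := by exact_mod_cast hq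
      nlinarith [mul_nonneg hη'0 hrA]
    have hle1 : rA * η ≤ 1 := by nlinarith
    exact ((sub_le_sub_right (Real.exp_le_exp.mpr hx1) 1).trans (exp_sub_one_le_two_mul (by positivity) hle1))
  have hHc : ‖holLine M (L ^ m * L ^ k) U' (xh, μ) c - 1‖ ≤ 2 * (rA * η) :=
    (norm_mprod_sub_one_le hκ0 fun i _ => hU'1 _ _).trans (hpow c hcL.le)
  have hTr : ‖holLine M (L ^ m * L ^ k) U' (xh + N • unitVec (fine (L ^ m * L ^ k) M) μ, μ) r - 1‖ ≤ 2 * (rA * η) :=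
    (norm_mprod_sub_one_le hκ0 fun i _ => hU'1 _ _).trans (hpow r hrL.le)
  have hNκ : (1 + κ) ^ N ≤ Real.exp 1 := by
    rw [h1κ, ← Real.exp_nat_mul]
    refine Real.exp_le_exp.mpr ?_
    have : (N : ℝ) * η' ≤ 1 := by
      have hN' : (N : ℝ) ≤ ((L ^ m * L ^ k : ℕ) : ℝ) := by exact_mod_cast hNle
      nlinarith
    nlinarith [mul_nonneg (Nat.cast_nonneg N) hη'0]
  -- the coarse line in fine-step factors
  have hco : (fun ν b => exp (η • Ab ν b)) = (fun ν b => exp ((((L ^ m : ℕ) : ℕ) : ℝ) • (η' • Ab ν b))) := by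
    funext ν b; rw [smul_smul, ← hηη']
  have hcoarse : holLine M (L ^ k) (fun ν b => exp (η • Ab ν b)) (kingPr L k m M x', μ) (s + δ) =
      mprod (fun t => exp (η' • Ab μ (kingPr L k m M x' + (t / L ^ m) • unitVec (fine (L ^ k) M) μ, μ))) N := by
    rw [hco, holLine_exp_smul_natCast M (L ^ k) (fun ν b => η' • Ab ν b) (L ^ m) hLm.ne' (kingPr L k m M x') μ (s + δ)]
  -- the fine long line from the cell start, position by position against the coarse factors
  have hG1 : ∀ t < N, ‖exp (η' • Ab μ (kingPr L k m M x' + (t / L ^ m) • unitVec (fine (L ^ k) M) μ, μ)) - 1‖ ≤ κ := fun t _ =>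
    norm_exp_smul_sub_one_le hη'0 (hAbn μ _)
  have hfac : ∀ t < N, ‖U' μ (xh + t • unitVec (fine (L ^ m * L ^ k) M) μ, μ) - exp (η' • Ab μ (kingPr L k m M x' + (t / L ^ m) • unitVec (fine (L ^ k) M) μ, μ))‖ ≤
      Real.exp (η' * rA) * (η' * Ω) := fun t _ => by
    have hproj : kingPrV L k m M (xh + t • unitVec (fine (L ^ m * L ^ k) M) μ, μ) = (kingPr L k m M x' + (t / L ^ m) • unitVec (fine (L ^ k) M) μ, μ) := by
      rw [kingPrV_eq, kingPr_add_smul_of_dvd M L k m xh μ hdvd t, hπh]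
    refine (norm_exp_sub_exp_le (ρ := η' * rA) ?_ ?_).trans ?_
    · rw [norm_smul, Real.norm_of_nonneg hη'0]; exact mul_le_mul_of_nonneg_left (hA μ _) hη'0
    · rw [norm_smul, Real.norm_of_nonneg hη'0]; exact mul_le_mul_of_nonneg_left (hAbn μ _) hη'0
    · refine mul_le_mul_of_nonneg_left ?_ (Real.exp_nonneg _)
      rw [← smul_sub, norm_smul, Real.norm_of_nonneg hη'0, ← hproj]
      exact mul_le_mul_of_nonneg_left (norm_sub_gavgM_kingPrV_le M L k m hstep μ _) hη'0
  have hPN : ‖holLine M (L ^ m * L ^ k) U' (xh, μ) N - mprod (fun t => exp (η' • Ab μ (kingPr L k m M x' + (t / L ^ m) • unitVec (fine (L ^ k) M) μ, μ))) N‖ ≤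
      Real.exp 1 * Ω * Real.exp 1 := by
    refine (norm_mprod_sub_mprod_le hκ0 (fun i _ => hU'1 _ _) hG1).trans ?_
    have hsum : ∑ i ∈ range N, ‖U' μ (xh + i • unitVec (fine (L ^ m * L ^ k) M) μ, μ) - exp (η' • Ab μ (kingPr L k m M x' + (i / L ^ m) • unitVec (fine (L ^ k) M) μ, μ))‖ ≤
        Real.exp 1 * Ω := by
      refine (sum_le_sum fun t ht => hfac t (mem_range.mp ht)).trans ?_
      rw [sum_const, card_range, nsmul_eq_mul]
      have he1 : Real.exp (η' * rA) ≤ Real.exp 1 := Real.exp_le_exp.mpr (by nlinarith [inv_le_one_of_one_le₀ (show (1:ℝ) ≤ ((L ^ m * L ^ k : ℕ) : ℝ) by exact_mod_cast Nat.mul_pos hLm hLk)])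
      have hNη : (N : ℝ) * η' ≤ 1 := by
        have hN' : (N : ℝ) ≤ ((L ^ m * L ^ k : ℕ) : ℝ) := by exact_mod_cast hNle
        nlinarith
      calc (N : ℝ) * (Real.exp (η' * rA) * (η' * Ω)) = ((N : ℝ) * η') * (Real.exp (η' * rA) * Ω) := by ring
        _ ≤ 1 * (Real.exp 1 * Ω) := mul_le_mul hNη (mul_le_mul_of_nonneg_right he1 hΩ0) (by positivity) zero_le_one
        _ = Real.exp 1 * Ω := one_mul _
    exact mul_le_mul hsum hNκ (by positivity) (by positivity)
  -- assemble: `H_c·ℓ′ = P_N·T_r`, `ℓ′ − ℓ̃ = H_cᴴ(P_N(T_r − 1) + (P_N − ℓ̃) + (1 − H_c)ℓ̃)`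
  have hHcu : (holLine M (L ^ m * L ^ k) U' (xh, μ) c)ᴴ * holLine M (L ^ m * L ^ k) U' (xh, μ) c = 1 := conjTranspose_mprod_mul_self fun t _ => hU'u _ _
  have hPNu : (holLine M (L ^ m * L ^ k) U' (xh, μ) N)ᴴ * holLine M (L ^ m * L ^ k) U' (xh, μ) N = 1 := conjTranspose_mprod_mul_self fun t _ => hU'u _ _
  have hI : holLine M (L ^ m * L ^ k) U' (xh, μ) c * holLine M (L ^ m * L ^ k) U' (x', μ) (L ^ m * s + j) =
      holLine M (L ^ m * L ^ k) U' (xh, μ) N * holLine M (L ^ m * L ^ k) U' (xh + N • unitVec (fine (L ^ m * L ^ k) M) μ, μ) r := by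
    rw [← holLine_add M (L ^ m * L ^ k) U' (xh, μ) N r, ← harith, holLine_add M (L ^ m * L ^ k) U' (xh, μ) c (L ^ m * s + j), ← hx']
  rw [hcoarse]
  set ℓt := mprod (fun t => exp (η' • Ab μ (kingPr L k m M x' + (t / L ^ m) • unitVec (fine (L ^ k) M) μ, μ))) N with hℓt
  set Hc := holLine M (L ^ m * L ^ k) U' (xh, μ) c with hHcdef
  set PN := holLine M (L ^ m * L ^ k) U' (xh, μ) N with hPNdef
  set Tr := holLine M (L ^ m * L ^ k) U' (xh + N • unitVec (fine (L ^ m * L ^ k) M) μ, μ) r with hTrdef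
  have hℓt1 : ‖ℓt‖ ≤ Real.exp 1 := by
    have h := norm_mprod_sub_one_le hκ0 hG1
    rw [← hℓt] at h
    calc ‖ℓt‖ = ‖(ℓt - 1) + 1‖ := by rw [sub_add_cancel]
      _ ≤ ‖ℓt - 1‖ + ‖(1 : Matrix mm mm ℂ)‖ := norm_add_le _ _
      _ ≤ ((1 + κ) ^ N - 1) + 1 := add_le_add h (by rw [norm_one])
      _ ≤ Real.exp 1 := by linarith
  have hkey : holLine M (L ^ m * L ^ k) U' (x', μ) (L ^ m * s + j) - ℓt = Hcᴴ * (PN * (Tr - 1) + (PN - ℓt) + (1 - Hc) * ℓt) := by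
    have h2 : Hcᴴ * (Hc * holLine M (L ^ m * L ^ k) U' (x', μ) (L ^ m * s + j)) = holLine M (L ^ m * L ^ k) U' (x', μ) (L ^ m * s + j) := by
      rw [← Matrix.mul_assoc, hHcu, Matrix.one_mul]
    rw [show PN * (Tr - 1) + (PN - ℓt) + (1 - Hc) * ℓt = PN * Tr - Hc * ℓt by noncomm_ring, ← hI, Matrix.mul_sub, h2, ← Matrix.mul_assoc, hHcu, Matrix.one_mul]
  rw [hkey, norm_unitary_mul_eq]
  · calc ‖PN * (Tr - 1) + (PN - ℓt) + (1 - Hc) * ℓt‖ ≤ ‖PN * (Tr - 1)‖ + ‖PN - ℓt‖ + ‖(1 - Hc) * ℓt‖ := norm_add₃_le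
      _ ≤ ‖Tr - 1‖ + Real.exp 1 * Ω * Real.exp 1 + ‖1 - Hc‖ * ‖ℓt‖ := by
          rw [norm_unitary_mul_eq hPNu]
          exact add_le_add (add_le_add le_rfl hPN) (norm_mul_le _ _)
      _ ≤ 2 * (rA * η) + Real.exp 1 * Ω * Real.exp 1 + 2 * (rA * η) * Real.exp 1 := by
          have h1 : ‖1 - Hc‖ ≤ 2 * (rA * η) := by rw [norm_sub_rev]; exact hHc
          have h2 : ‖1 - Hc‖ * ‖ℓt‖ ≤ 2 * (rA * η) * Real.exp 1 := mul_le_mul h1 hℓt1 (norm_nonneg _) (by positivity)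
          linarith [hTr]
      _ = _ := by rw [hΩ]; ring
  · -- `H_cᴴ` is unitary too
    rw [Matrix.conjTranspose_conjTranspose]
    exact mul_eq_one_comm.mp hHcu

omit [∀ μ, NeZero (M μ)] [Nonempty mm] in
/-- The staircase holonomy of a unitary field is unitary. [folklore] -/
theorem holStair_unitary {n : ℕ} [NeZero n] {U : Fin (d + 1) → Tor (fine n M) × Fin (d + 1) → Matrix mm mm ℂ} (hU : ∀ μ p, (U μ p)ᴴ * U μ p = 1)
    (y : Tor M) (a : Fin (d + 1) → Fin n) (ν : Fin (d + 1)) : (holStair M n U y a ν)ᴴ * holStair M n U y a ν = 1 := by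
  refine conjTranspose_mprod_mul_self fun i hi => ?_
  rw [dif_pos hi]
  exact conjTranspose_mprod_mul_self fun t _ => hU _ _

omit [∀ μ, NeZero (M μ)] [Nonempty mm] in
/-- The line holonomy of a unitary field is unitary. [folklore] -/
theorem holLine_unitary {n : ℕ} [NeZero n] {U : Fin (d + 1) → Tor (fine n M) × Fin (d + 1) → Matrix mm mm ℂ} (hU : ∀ μ p, (U μ p)ᴴ * U μ p = 1)
    (p : Tor (fine n M) × Fin (d + 1)) (t : ℕ) : (holLine M n U p t)ᴴ * holLine M n U p t = 1 :=
  conjTranspose_mprod_mul_self fun _ _ => hU _ _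

/-- ★★ **THE PATH HOLONOMIES OF (125) AT TWO SPACINGS FIT**: under the hypotheses of `norm_holLine_two_grid_le`, the holonomy of `e^{η′A′}` along the fine path `(x′, L^ms + j)` and the holonomy of
`e^{ηĀ′}` along the projected coarse path `(πx′, s + δ)` differ by at most the staircase bound of `norm_holStair_two_grid_le` plus the line bound of `norm_holLine_two_grid_le` — both `O(r_A·η)`
(`‖S′ℓ′ − Sℓ‖ ≤ ‖S′ − S‖ + ‖ℓ′ − ℓ‖` for unitary holonomies). [cite: Balaban1985BackgroundPropagators, (3.73) p.405 (shape); Balaban1985Averaging, (125)–(126) p.36] -/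
theorem norm_holPath_two_grid_le {A' : Fin (d + 1) → Tor (fine (L ^ m * L ^ k) M) × Fin (d + 1) → Matrix mm mm ℂ} {rA : ℝ} (hrA : 0 ≤ rA) (hrA1 : rA ≤ 1)
    (hA : ∀ μ b', ‖A' μ b'‖ ≤ rA) (hstep : ∀ μ κ b', ‖A' μ (bshiftEquiv M (L ^ m * L ^ k) κ b') - A' μ b'‖ ≤ rA * ((((L ^ m * L ^ k : ℕ) : ℝ))⁻¹))
    (hAs : ∀ μ b', (A' μ b')ᴴ = -A' μ b') (x' : Tor (fine (L ^ m * L ^ k) M)) (μ : Fin (d + 1)) {s j δ : ℕ} (hs : s < L ^ k) (hj : j < L ^ m) (hδ : δ ≤ 1)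
    (hM2 : 2 ≤ L ^ k * M μ) (hπ : kingPr L k m M (x' + j • unitVec (fine (L ^ m * L ^ k) M) μ) = kingPr L k m M x' + δ • unitVec (fine (L ^ k) M) μ) :
    ‖holPath M (L ^ m * L ^ k) (fun μ b => exp (((((L ^ m * L ^ k : ℕ) : ℝ))⁻¹) • A' μ b)) (x', μ) (L ^ m * s + j) -
        holPath M (L ^ k) (fun μ b => exp (((((L ^ k : ℕ) : ℝ))⁻¹) • gavgM (Matrix mm mm ℂ) (Fin (d + 1)) (kingPrV L k m M) A' μ b)) (kingPr L k m M x', μ) (s + δ)‖ ≤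
      3 ^ (d + 1) * ((d + 1) * (36 * ((L ^ m * L ^ k : ℕ) : ℝ) * (((((L ^ m * L ^ k : ℕ) : ℝ))⁻¹) * ((2 * ((d + 1) * (L ^ m - 1)) : ℕ) * (rA * ((((L ^ m * L ^ k : ℕ) : ℝ))⁻¹)))) +
        9 * (((L ^ m : ℕ) : ℝ) * (((((L ^ m * L ^ k : ℕ) : ℝ))⁻¹) * rA)))) +
      (2 * (rA * ((((L ^ k : ℕ) : ℝ))⁻¹)) + 2 * (rA * ((((L ^ k : ℕ) : ℝ))⁻¹)) * Real.exp 1 +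
        Real.exp 1 * ((2 * ((d + 1) * (L ^ m - 1)) : ℕ) * (rA * ((((L ^ m * L ^ k : ℕ) : ℝ))⁻¹))) * Real.exp 1) := by
  obtain ⟨⟨y, a'⟩, hxy⟩ := (B5Blocks16.bpt_bijective (L ^ m * L ^ k) M).2 x'
  have hU'u : ∀ ν b, (exp (((((L ^ m * L ^ k : ℕ) : ℝ))⁻¹) • A' ν b))ᴴ * exp (((((L ^ m * L ^ k : ℕ) : ℝ))⁻¹) • A' ν b) = 1 := fun ν b =>
    CurvedSpecies.exp_smul_unitary_of_conjTranspose (hAs ν b) _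
  have hUu : ∀ ν b, (exp (((((L ^ k : ℕ) : ℝ))⁻¹) • gavgM (Matrix mm mm ℂ) (Fin (d + 1)) (kingPrV L k m M) A' ν b))ᴴ *
      exp (((((L ^ k : ℕ) : ℝ))⁻¹) • gavgM (Matrix mm mm ℂ) (Fin (d + 1)) (kingPrV L k m M) A' ν b) = 1 := fun ν b =>
    CurvedSpecies.exp_smul_unitary_of_conjTranspose (Gluing.gavgM_conjTranspose_of_skew (kingPrV L k m M) hAs ν b) _
  have hbc' : blockCoords (L ^ m * L ^ k) M x' = (y, a') := by rw [← hxy]; exact blockCoords_bpt (L ^ m * L ^ k) M y a'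
  have hbc : blockCoords (L ^ k) M (kingPr L k m M x') = (y, hdig L k m a') := by rw [← hxy, kingPr_bpt_hdig]; exact blockCoords_bpt (L ^ k) M y (hdig L k m a')
  rw [holPath, holPath, hbc', hbc]
  dsimp only
  set S' := holStair M (L ^ m * L ^ k) (fun μ b => exp (((((L ^ m * L ^ k : ℕ) : ℝ))⁻¹) • A' μ b)) y a' μ
  set S := holStair M (L ^ k) (fun μ b => exp (((((L ^ k : ℕ) : ℝ))⁻¹) • gavgM (Matrix mm mm ℂ) (Fin (d + 1)) (kingPrV L k m M) A' μ b)) y (hdig L k m a') μ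
  set l' := holLine M (L ^ m * L ^ k) (fun μ b => exp (((((L ^ m * L ^ k : ℕ) : ℝ))⁻¹) • A' μ b)) (x', μ) (L ^ m * s + j)
  set l := holLine M (L ^ k) (fun μ b => exp (((((L ^ k : ℕ) : ℝ))⁻¹) • gavgM (Matrix mm mm ℂ) (Fin (d + 1)) (kingPrV L k m M) A' μ b)) (kingPr L k m M x', μ) (s + δ)
  have hl'u : l'ᴴ * l' = 1 := holLine_unitary M hU'u _ _
  have hSu : Sᴴ * S = 1 := holStair_unitary M hUu _ _ _
  have hsplit : S' * l' - S * l = (S' - S) * l' + S * (l' - l) := by noncomm_ring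
  rw [hsplit]
  calc ‖(S' - S) * l' + S * (l' - l)‖ ≤ ‖(S' - S) * l'‖ + ‖S * (l' - l)‖ := norm_add_le _ _
    _ = ‖S' - S‖ + ‖l' - l‖ := by rw [norm_mul_unitary_eq hl'u, norm_unitary_mul_eq hSu]
    _ ≤ _ := add_le_add (norm_holStair_two_grid_le M k m hrA hrA1 hA hstep y a' μ) (norm_holLine_two_grid_le M k m hrA hrA1 hA hstep hAs x' μ hs hj hδ hM2 hπ)

end TwoGrid

end Summit.QuantumFields.YangMills.BalabanUVNodes.N15.CovAvg

end
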